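import Summits.AtomisticToContinuum.FouriersLaw.Theses.ContactEchoEpochs
import Literature.MathematicalPhysics.KineticTheory.LangevinChainNESSHolds

/-!
# Existence of a weak steady state of the pinned anharmonic chain (`PinnedSteadyStateExists`), proved

Closes item `stmt-AtomisticToContinuum-9900` — the decl `PinnedSteadyStateExists` of the route
`Summits/AtomisticToContinuum/FouriersLaw/Theses/ContactEchoEpochs` (shared verbatim by the Fourier routes
as clause (i)-existence of `FouriersLawFor`): for `pinnedChain ω₂ lam β γ` with `ω₂, lam, β, γ > 0`, every
length `N` and all bath temperatures `T_L, T_R > 0` there is a measure in the weak Fokker–Planck class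
`OscillatorChain.IsSteadyState N T_L T_R`.

The statement is, binder for binder, the in-tree theorem
`Literature.MathematicalPhysics.KineticTheory.HeatConduction.pinnedChain_exists_isSteadyState`
(`Literature/MathematicalPhysics/KineticTheory/LangevinChainNESSHolds.lean`): for `N ≥ 1` the discharged
named fact `CuneoEckmannHairerReyBellet2018_pinnedChain` (Cuneo–Eckmann–Hairer–Rey-Bellet 2018, Thm 2.13:
the Lyapunov/Hörmander construction of the invariant probability measure of the Langevin chain, which is a
weak steady state), and for `N = 0` the point mass (`OscillatorChain.isSteadyState_zero`). The route files
take this existence as a hypothesis of their deciding theorem `closes` precisely so that they need not import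
the Langevin-SDE cone; this file is where that cone is imported.

No definitions, no named-fact hypotheses.
-/

namespace Summit.AtomisticToContinuum.FouriersLaw.Theorems

/-- `PinnedSteadyStateExists` (item `stmt-AtomisticToContinuum-9900`): for the pinned anharmonic chain
`pinnedChain ω₂ lam β γ` with positive parameters, every `N : ℕ` and all `T_L, T_R > 0`, some measure on
`PhaseSpace N` is a weak steady state, `(pinnedChain ω₂ lam β γ).IsSteadyState N T_L T_R μ`.
Proof: the in-tree theorem `pinnedChain_exists_isSteadyState` (Cuneo–Eckmann–Hairer–Rey-Bellet 2018,
Thm 2.13 for `N ≥ 1`; the point mass for `N = 0`). -/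
theorem pinnedSteadyStateExists_proof :
    Summit.AtomisticToContinuum.FouriersLaw.Theses.ContactEchoEpochs.PinnedSteadyStateExists := by
  unfold Summit.AtomisticToContinuum.FouriersLaw.Theses.ContactEchoEpochs.PinnedSteadyStateExists
  intro ω₂ lam β γ hω hl hβ hγ N T_L T_R hL hR
  exact Literature.MathematicalPhysics.KineticTheory.HeatConduction.pinnedChain_exists_isSteadyState
    hω hl hβ hγ N hL hR

end Summit.AtomisticToContinuum.FouriersLaw.Theorems
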